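import Summits.AtomisticToContinuum.FouriersLaw.Theses.CageBudgetFekete
import Literature.MathematicalPhysics.KineticTheory.InfiniteChainShiftInvariantUniqueness
import Literature.MathematicalPhysics.KineticTheory.InfiniteChainCorrelationContinuity
import Literature.MathematicalPhysics.KineticTheory.InfiniteChainCurrentMoments

/-!
# Birth skeleton (BC3) for crux `HeatVarianceCalculus` — route CageBudgetFekete, item stmt-AtomisticToContinuum-15772

Crux (route decl `Summit.AtomisticToContinuum.FouriersLaw.Theses.CageBudgetFekete.HeatVarianceCalculus`, FIXED): for every
guarded pair (μ_T Gibbs + shift- and momentum-reversal invariant, D a μ_T-preserving dynamics whose flow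
commutes with the one-step shift a.e.) of the pinned chain: (a) the summed current correlation
`C_T(t) = Σ_x ∫ j_0 (j_x ∘ φ_t) dμ_T` converges absolutely at every `t`; (b) `t ↦ C_T(t)` is continuous;
(c) the heat variance `V_T(τ) = 2∫₀^τ (τ-s) C_T(s) ds ≥ 0`; (d) for every `ν > 0` the Laplace
integrability of `e^{-νt}C_T`, `e^{-νt}V_T` and the identity `∫₀^∞ e^{-νt}C_T = (ν²/2)∫₀^∞ e^{-νt}V_T`.

## Line (three named stubs + kernel-checked composition)

* `stub_locallyUniformClustering` (LOAD-BEARING, size L, the open kernel named by the grounder):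
  space-time summable clustering of the current pair correlations, locally uniformly in time — for every
  time window `|t| ≤ τ` a summable majorant `m_τ : ℤ → ℝ` of `x ↦ |∫ j_0 (j_x ∘ φ_t) dμ_T|`. Physics:
  finite-speed (light-cone) estimates of Buttà–Caglioti–Di Ruzza–Marchioro type for the superstable
  flow + exponential mixing of the one-dimensional Gibbs state (transfer operator). Leans on (tree):
  `OscillatorChain.hasSuperstabilityEstimate_of_isShiftInvariant_pinnedChain`,
  `InfiniteChainClusteringTransfer.summable_covariance_comp_chainShift` (static clustering),
  `InfiniteChainLightCone*`, `InfiniteChainL2Locality*` (propagation); sources ButtaEtAl2007,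
  ButtaMarchioro2016, LanfordLebowitzLieb1977.
* `stub_positiveType` (size M, provable now): Bochner structure of `C_T` in infinite volume —
  `|C_T(t)| ≤ C_T(0)` and `0 ≤ ∫_{(0,τ]} (τ-u) C_T(u) du` (= V_T(τ)/2) for `τ ≥ 0`, given absolute
  convergence at every time. Leans on (tree): `InfiniteChainDynamics.currentCorrelation_positiveType`
  (Fejér representation `C = lim n⁻¹∫J_n(J_n∘φ_t)`, no Bochner/Stone theorem) once the ONE-STEP a.e.
  shift covariance of the guard is iterated to `φ_t ∘ τ_x = τ_x ∘ φ_t` a.e. for every `x ∈ ℤ`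
  (quasi-measure-preservation of the shift under the shift-invariant `μ_T`) and superstability of the
  shift-invariant Gibbs state is invoked; Helfand1960 for the variance reading.
* `stub_laplaceHeatVariance` (size M, pure real analysis): for ANY continuous bounded `C : ℝ → ℝ` and
  `V(τ) := 2∫_{(0,τ]}(τ-s)C(s)ds`: `e^{-νt}C`, `e^{-νt}V` are integrable on `(0,∞)` (`|V(τ)| ≤ Mτ²`) and
  `∫₀^∞ e^{-νt}C = (ν²/2)∫₀^∞ e^{-νt}V` (Fubini / two integrations by parts: `V'' = 2C`, `V(0) = V'(0) = 0`,
  `∫_s^∞ (t-s)e^{-νt}dt = e^{-νs}/ν²`). Leans on Mathlib (`integral_exp_mul_Ioi`,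
  `Real.integral_rpow_mul_exp_neg_mul_Ioi`, `MeasureTheory.integral_integral_swap`).
* `HeatVarianceCalculus_of_stubs : BirthLine` (= stub₁-sig → stub₂-sig → stub₃-sig → crux; PROVED, no sorry,
  axioms propext/Classical.choice/Quot.sound) and `HeatVarianceCalculus_of : HeatVarianceCalculus` (the crux BY
  NAME from the three stubs by name, the shape `#h21_check_skeleton` audits): (a) from the majorant at `τ = |t|` + in-tree
  integrability of the terms under superstability; (b) by the Weierstrass M-test on the open windows
  `(-|t₀|-1, |t₀|+1)` with the in-tree continuity of each term
  (`continuous_integral_bondCurrentZ_mul_flow_pinnedChain`); (c) from `stub_positiveType`; (d) from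
  `stub_laplaceHeatVariance` with `M = C_T(0)`.

Hardest stub: `stub_locallyUniformClustering` (it is clause (a) with the uniformity that makes (b) a
corollary; nothing of BCDM type is vendored for the deg-3 coupling). Disproof used: none exists for this
crux (`ledger crux ls` shows no Disproof.lean, `ledger negatives` has no entry touching C_T-regularity).
Costume check: no stub mentions `FouriersLaw`, the heat variance Laplace identity, or continuity of
`C_T`; BC3 probes `stub → crux` / `stub → FouriersLaw` by `first | exact? | simpa | aesop` fail 6/6
(folder `bc/HeatVarianceCalculus_probe.lean`).
-/

namespace Summit.AtomisticToContinuum.FouriersLaw.Cruxes.HeatVarianceCalculus.Birth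

open MeasureTheory Filter Set
open scoped Topology BigOperators

/-- **Stub 1 (load-bearing, L): locally-uniform-in-time summable space-time clustering of the current
pair correlations.** For every guarded `(μ_T, D)` of the pinned chain and every time window `τ` there
is a summable `m : ℤ → ℝ` with `|∫ j_0 · (j_x ∘ φ_t) dμ_T| ≤ m x` for all `|t| ≤ τ`, `x ∈ ℤ`.
Why plausibly true: light-cone bounds for the superstable flow (BCDM/BM) make `j_x ∘ φ_t` exponentially
close to a function of the window `[x - vτ - ℓ, x + vτ + ℓ]`, and the 1-D Gibbs state is exponentially
mixing (transfer operator), so the static clustering `summable_covariance_comp_chainShift` transfers to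
fixed `t` with constants uniform on `|t| ≤ τ`. [sources: ButtaEtAl2007, ButtaMarchioro2016,
LanfordLebowitzLieb1977, BonettoLebowitzReyBellet2000] -/
theorem stub_locallyUniformClustering :
    ∀ ω₂ lam β γ : ℝ, 0 < ω₂ → 0 < lam → 0 < β → ∀ T : ℝ, 0 < T →
    ∀ μ : MeasureTheory.Measure Literature.MathematicalPhysics.KineticTheory.HeatConduction.ChainConfig,
    (Literature.MathematicalPhysics.KineticTheory.HeatConduction.pinnedChain ω₂ lam β γ).IsChainGibbsMeasure T μ →
    Literature.MathematicalPhysics.KineticTheory.HeatConduction.IsShiftInvariant μ →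
    μ.map (fun σ : Literature.MathematicalPhysics.KineticTheory.HeatConduction.ChainConfig => fun x : ℤ => ((σ x).1, -(σ x).2)) = μ →
    ∀ D : Literature.MathematicalPhysics.KineticTheory.HeatConduction.InfiniteChainDynamics (Literature.MathematicalPhysics.KineticTheory.HeatConduction.pinnedChain ω₂ lam β γ),
    D.PreservesMeasure μ →
    (∀ t : ℝ, ∀ᵐ σ ∂μ, D.flow t (Literature.MathematicalPhysics.KineticTheory.HeatConduction.shift σ) = Literature.MathematicalPhysics.KineticTheory.HeatConduction.shift (D.flow t σ)) →
    ∀ τ : ℝ, ∃ m : ℤ → ℝ, Summable m ∧ ∀ t : ℝ, |t| ≤ τ → ∀ x : ℤ,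
      |∫ σ, (Literature.MathematicalPhysics.KineticTheory.HeatConduction.pinnedChain ω₂ lam β γ).bondCurrentZ σ 0 *
          (Literature.MathematicalPhysics.KineticTheory.HeatConduction.pinnedChain ω₂ lam β γ).bondCurrentZ (D.flow t σ) x ∂μ| ≤ m x := by
  sorry

/-- **Stub 2 (M): Bochner structure of `C_T` in infinite volume.** For every guarded `(μ_T, D)` with
absolutely convergent correlation sums at every time: `|C_T(t)| ≤ C_T(0)` for all `t` and
`0 ≤ ∫_{(0,τ]} (τ - u) C_T(u) du` for all `τ ≥ 0` (half the heat variance).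
Why plausibly true / route to proof: iterate the guard's one-step a.e. shift covariance to all `x ∈ ℤ`
(the shift is `μ_T`-preserving), get superstability of the shift-invariant Gibbs state from
`OscillatorChain.hasSuperstabilityEstimate_of_isShiftInvariant_pinnedChain`, and apply
`InfiniteChainDynamics.currentCorrelation_positiveType`. [sources: Helfand1960, ButtaMarchioro2016] -/
theorem stub_positiveType :
    ∀ ω₂ lam β γ : ℝ, 0 < ω₂ → 0 < lam → 0 < β → ∀ T : ℝ, 0 < T →
    ∀ μ : MeasureTheory.Measure Literature.MathematicalPhysics.KineticTheory.HeatConduction.ChainConfig,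
    (Literature.MathematicalPhysics.KineticTheory.HeatConduction.pinnedChain ω₂ lam β γ).IsChainGibbsMeasure T μ →
    Literature.MathematicalPhysics.KineticTheory.HeatConduction.IsShiftInvariant μ →
    μ.map (fun σ : Literature.MathematicalPhysics.KineticTheory.HeatConduction.ChainConfig => fun x : ℤ => ((σ x).1, -(σ x).2)) = μ →
    ∀ D : Literature.MathematicalPhysics.KineticTheory.HeatConduction.InfiniteChainDynamics (Literature.MathematicalPhysics.KineticTheory.HeatConduction.pinnedChain ω₂ lam β γ),
    D.PreservesMeasure μ →
    (∀ t : ℝ, ∀ᵐ σ ∂μ, D.flow t (Literature.MathematicalPhysics.KineticTheory.HeatConduction.shift σ) = Literature.MathematicalPhysics.KineticTheory.HeatConduction.shift (D.flow t σ)) →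
    (∀ t : ℝ, D.HasAbsConvergentCorrelation μ t) →
    (∀ t : ℝ, |D.currentCorrelation μ t| ≤ D.currentCorrelation μ 0) ∧
      ∀ τ : ℝ, 0 ≤ τ → 0 ≤ ∫ u in Set.Ioc (0:ℝ) τ, (τ - u) * D.currentCorrelation μ u := by
  sorry

/-- **Stub 3 (M): Laplace calculus of the doubly integrated correlation (pure real analysis).** For a
continuous bounded `C` and `V(τ) = 2∫_{(0,τ]} (τ - s) C(s) ds`, for every `ν > 0`: `e^{-νt} C` and
`e^{-νt} V` are integrable on `(0, ∞)` and `∫₀^∞ e^{-νt} C(t) dt = (ν²/2) ∫₀^∞ e^{-νt} V(t) dt`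
(`V'' = 2C`, `V(0) = V'(0) = 0`; Fubini with `∫_s^∞ (t - s) e^{-νt} dt = e^{-νs}/ν²`). [sources: Helfand1960;
Mathlib `integral_exp_mul_Ioi`, `Real.integral_rpow_mul_exp_neg_mul_Ioi`] -/
theorem stub_laplaceHeatVariance :
    ∀ C : ℝ → ℝ, Continuous C → (∃ M : ℝ, ∀ t : ℝ, |C t| ≤ M) → ∀ V : ℝ → ℝ,
    V = (fun τ : ℝ => 2 * ∫ s in Set.Ioc (0:ℝ) τ, (τ - s) * C s) → ∀ ν : ℝ, 0 < ν →
    MeasureTheory.IntegrableOn (fun t : ℝ => Real.exp (-(ν * t)) * C t) (Set.Ioi 0) ∧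
    MeasureTheory.IntegrableOn (fun t : ℝ => Real.exp (-(ν * t)) * V t) (Set.Ioi 0) ∧
    ∫ t in Set.Ioi (0:ℝ), Real.exp (-(ν * t)) * C t =
      ν ^ 2 / 2 * ∫ t in Set.Ioi (0:ℝ), Real.exp (-(ν * t)) * V t := by
  sorry

/-- **The line as one proposition**: the three stub statements imply the crux (hypothesis form of BC3,
`stub₁-sig → stub₂-sig → stub₃-sig → HeatVarianceCalculus`; wrapped in a `def` so that the skeleton audit sees
exactly ONE theorem concluding the crux by name, `HeatVarianceCalculus_of` below). [folklore] -/
def BirthLine : Prop :=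
    (∀ ω₂ lam β γ : ℝ, 0 < ω₂ → 0 < lam → 0 < β → ∀ T : ℝ, 0 < T →
    ∀ μ : MeasureTheory.Measure Literature.MathematicalPhysics.KineticTheory.HeatConduction.ChainConfig,
    (Literature.MathematicalPhysics.KineticTheory.HeatConduction.pinnedChain ω₂ lam β γ).IsChainGibbsMeasure T μ →
    Literature.MathematicalPhysics.KineticTheory.HeatConduction.IsShiftInvariant μ →
    μ.map (fun σ : Literature.MathematicalPhysics.KineticTheory.HeatConduction.ChainConfig => fun x : ℤ => ((σ x).1, -(σ x).2)) = μ →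
    ∀ D : Literature.MathematicalPhysics.KineticTheory.HeatConduction.InfiniteChainDynamics (Literature.MathematicalPhysics.KineticTheory.HeatConduction.pinnedChain ω₂ lam β γ),
    D.PreservesMeasure μ →
    (∀ t : ℝ, ∀ᵐ σ ∂μ, D.flow t (Literature.MathematicalPhysics.KineticTheory.HeatConduction.shift σ) = Literature.MathematicalPhysics.KineticTheory.HeatConduction.shift (D.flow t σ)) →
    ∀ τ : ℝ, ∃ m : ℤ → ℝ, Summable m ∧ ∀ t : ℝ, |t| ≤ τ → ∀ x : ℤ,
      |∫ σ, (Literature.MathematicalPhysics.KineticTheory.HeatConduction.pinnedChain ω₂ lam β γ).bondCurrentZ σ 0 *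
          (Literature.MathematicalPhysics.KineticTheory.HeatConduction.pinnedChain ω₂ lam β γ).bondCurrentZ (D.flow t σ) x ∂μ| ≤ m x) →
    (∀ ω₂ lam β γ : ℝ, 0 < ω₂ → 0 < lam → 0 < β → ∀ T : ℝ, 0 < T →
    ∀ μ : MeasureTheory.Measure Literature.MathematicalPhysics.KineticTheory.HeatConduction.ChainConfig,
    (Literature.MathematicalPhysics.KineticTheory.HeatConduction.pinnedChain ω₂ lam β γ).IsChainGibbsMeasure T μ →
    Literature.MathematicalPhysics.KineticTheory.HeatConduction.IsShiftInvariant μ →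
    μ.map (fun σ : Literature.MathematicalPhysics.KineticTheory.HeatConduction.ChainConfig => fun x : ℤ => ((σ x).1, -(σ x).2)) = μ →
    ∀ D : Literature.MathematicalPhysics.KineticTheory.HeatConduction.InfiniteChainDynamics (Literature.MathematicalPhysics.KineticTheory.HeatConduction.pinnedChain ω₂ lam β γ),
    D.PreservesMeasure μ →
    (∀ t : ℝ, ∀ᵐ σ ∂μ, D.flow t (Literature.MathematicalPhysics.KineticTheory.HeatConduction.shift σ) = Literature.MathematicalPhysics.KineticTheory.HeatConduction.shift (D.flow t σ)) →
    (∀ t : ℝ, D.HasAbsConvergentCorrelation μ t) →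
    (∀ t : ℝ, |D.currentCorrelation μ t| ≤ D.currentCorrelation μ 0) ∧
      ∀ τ : ℝ, 0 ≤ τ → 0 ≤ ∫ u in Set.Ioc (0:ℝ) τ, (τ - u) * D.currentCorrelation μ u) →
    (∀ C : ℝ → ℝ, Continuous C → (∃ M : ℝ, ∀ t : ℝ, |C t| ≤ M) → ∀ V : ℝ → ℝ,
    V = (fun τ : ℝ => 2 * ∫ s in Set.Ioc (0:ℝ) τ, (τ - s) * C s) → ∀ ν : ℝ, 0 < ν →
    MeasureTheory.IntegrableOn (fun t : ℝ => Real.exp (-(ν * t)) * C t) (Set.Ioi 0) ∧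
    MeasureTheory.IntegrableOn (fun t : ℝ => Real.exp (-(ν * t)) * V t) (Set.Ioi 0) ∧
    ∫ t in Set.Ioi (0:ℝ), Real.exp (-(ν * t)) * C t =
      ν ^ 2 / 2 * ∫ t in Set.Ioi (0:ℝ), Real.exp (-(ν * t)) * V t) →
    Summit.AtomisticToContinuum.FouriersLaw.Theses.CageBudgetFekete.HeatVarianceCalculus

open Literature.MathematicalPhysics.KineticTheory.HeatConduction in
/-- **Composition, hypothesis form (kernel-checked, axioms ⊆ propext/Classical.choice/Quot.sound): the three
stub STATEMENTS give the crux `HeatVarianceCalculus`.**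
(a) absolute convergence from the majorant of Stub 1 at the window `τ = |t|` and the in-tree
integrability of the terms under superstability; (b) continuity of `C_T = Σ_x c_x` by the Weierstrass
M-test on open time windows, each term `c_x` being continuous in tree; (c) `V_T ≥ 0` from Stub 2;
(d) the Laplace clauses from Stub 3 with the bound `M = C_T(0)` of Stub 2. [folklore] -/
theorem HeatVarianceCalculus_of_stubs : BirthLine := by
  intro h1 h2 h3 ω₂ lam β γ hω hl hβ T hT μ hG hSI hRefl D hP hShift
  -- superstability of the shift-invariant Gibbs state and the polynomial data of the chain (in tree)
  have hss : (pinnedChain ω₂ lam β γ).HasSuperstabilityEstimate μ :=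
    OscillatorChain.hasSuperstabilityEstimate_of_isShiftInvariant_pinnedChain γ hω hl.le hβ.le hT hG hSI
  have hU0 : ∀ q : ℝ, 0 ≤ (pinnedChain ω₂ lam β γ).U q :=
    OscillatorChain.pinnedChain_U_nonneg β γ hω.le hl.le
  have hUm : Measurable (pinnedChain ω₂ lam β γ).U := OscillatorChain.measurable_pinnedChain_U ω₂ lam β γ
  have hV2 : OscillatorChain.IsEvenPolyOfDegree (pinnedChain ω₂ lam β γ).V 2 :=
    OscillatorChain.pinnedChain_isEvenPolyOfDegree_V ω₂ lam γ hβ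
  -- the terms `c_x(t) = ∫ j_0 (j_x ∘ φ_t) dμ`: continuous in `t` and with integrable integrands (in tree)
  have hcont : ∀ x : ℤ, Continuous fun t : ℝ =>
      ∫ σ, (pinnedChain ω₂ lam β γ).bondCurrentZ σ 0 *
        (pinnedChain ω₂ lam β γ).bondCurrentZ (D.flow t σ) x ∂μ := fun x =>
    InfiniteChainDynamics.continuous_integral_bondCurrentZ_mul_flow_pinnedChain γ hω.le hl.le hβ hss D hP x 0
  have hint : ∀ (t : ℝ) (x : ℤ), Integrable (fun σ =>
      (pinnedChain ω₂ lam β γ).bondCurrentZ σ 0 *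
        (pinnedChain ω₂ lam β γ).bondCurrentZ (D.flow t σ) x) μ := fun t x =>
    hss.integrable_bondCurrentZ_mul_comp one_le_two hU0 hUm hV2 (hP.2 t) x 0
  have h1' := h1 ω₂ lam β γ hω hl hβ T hT μ hG hSI hRefl D hP hShift
  -- (a) absolute convergence of the correlation sum at every time
  have hAC : ∀ t : ℝ, D.HasAbsConvergentCorrelation μ t := fun t => by
    obtain ⟨m, hm, hb⟩ := h1' |t|
    exact ⟨fun x => hint t x,
      Summable.of_nonneg_of_le (fun x => abs_nonneg _) (fun x => hb t le_rfl x) hm⟩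
  -- (b) continuity of `C_T`: Weierstrass M-test on the open window `(-(|t₀|+1), |t₀|+1)`
  have hC : Continuous fun t : ℝ => D.currentCorrelation μ t := by
    refine continuous_iff_continuousAt.2 fun t₀ => ?_
    obtain ⟨m, hm, hb⟩ := h1' (|t₀| + 1)
    have hon : ContinuousOn (fun t : ℝ => ∑' x : ℤ,
        ∫ σ, (pinnedChain ω₂ lam β γ).bondCurrentZ σ 0 *
          (pinnedChain ω₂ lam β γ).bondCurrentZ (D.flow t σ) x ∂μ)
        (Set.Ioo (-(|t₀| + 1)) (|t₀| + 1)) :=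
      continuousOn_tsum (fun x => (hcont x).continuousOn) hm fun x t ht => by
        rw [Real.norm_eq_abs]
        exact hb t (abs_le.2 ⟨ht.1.le, ht.2.le⟩) x
    exact hon.continuousAt
      (Ioo_mem_nhds (by linarith [neg_abs_le t₀]) (by linarith [le_abs_self t₀]))
  -- (c) + the bound `|C_T| ≤ C_T(0)` from Stub 2
  obtain ⟨hbd, hpos⟩ := h2 ω₂ lam β γ hω hl hβ T hT μ hG hSI hRefl D hP hShift hAC
  refine ⟨hAC, hC, fun V hV => ⟨fun τ hτ => ?_, fun ν hν => ?_⟩⟩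
  · subst hV
    dsimp only
    exact mul_nonneg zero_le_two (hpos τ hτ)
  · -- (d) the Laplace clauses from Stub 3 with `M = C_T(0)`
    exact h3 (fun t : ℝ => D.currentCorrelation μ t) hC ⟨D.currentCorrelation μ 0, hbd⟩ V hV ν hν

/-- **Skeleton theorem (audit shape): the crux `HeatVarianceCalculus` BY NAME from the three declared stubs
by name** — `sorry` enters only through `stub_locallyUniformClustering`, `stub_positiveType`,
`stub_laplaceHeatVariance`; closing the three stubs closes the crux verbatim. [folklore] -/
theorem HeatVarianceCalculus_of : Summit.AtomisticToContinuum.FouriersLaw.Theses.CageBudgetFekete.HeatVarianceCalculus :=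
  HeatVarianceCalculus_of_stubs stub_locallyUniformClustering stub_positiveType stub_laplaceHeatVariance

end Summit.AtomisticToContinuum.FouriersLaw.Cruxes.HeatVarianceCalculus.Birth
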